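import Summits.Ventures.PercRepro.Night2StarIdentity

/-!
# PercRepro — the type-`3` balance as a counting identity (night-2, NIGHT-2-t3.md §4, Lemma A)

For a rank-`q` set `G` the landed type-`3` balance is
`Jq M G q 3 = Σ_{S ∈ R_q(G)} (q − 1)·w_∞(S) − Φ·#{S : ρ(G ∖ S) ≥ 3}`, `w_∞(S) = 1/(1 + m(S))`, `Φ = (q + 2)/(q + 1)`.
Writing `(q − 1)/(1 + m) = 1 + (q − 2 − m)/(1 + m)` and splitting `R_q(G)` into the bases (`m = q`) and the
spanning non-bases gives the exact identity (**Lemma A**)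
`J_3 = DF_3 − (N_q − DF_3 + 2·#𝓑)/(q + 1) + Σ_{S spanning non-basis} (q − 2 − m(S))/(1 + m(S))`
(`DF_3` = the demand-free rank-`q` subsets, `ρ(G ∖ S) ≤ 2`).  On a simple matroid every spanning non-basis has
`m(S) ≤ q − 2` (`mTr_add_two_le_of_spanning_nonbasis`), so the last sum is nonnegative and
`J_3 ≥ DF_3 − (N_q − DF_3 + 2·#𝓑)/(q + 1)`: the type-`3` balance is nonnegative as soon as
`N_q − DF_3 + 2·#𝓑 ≤ (q + 1)·DF_3` (**Corollary A1**, the coloop tail).  No charging rule is involved.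
Imports `Night2StarIdentity` only.
-/
namespace PercRepro.Star

open Finset ThmH SixFour GenQ

variable {α : Type*} [DecidableEq α] {M : Matroid α} [M.Finite]

/-! ## The low-coloop sum -/

/-- `Σ_{S spanning non-basis} (q − 2 − m(S))/(1 + m(S))`: the low-coloop part of the type-`3` balance
(`0` at `m = q − 2`, positive below it). -/
noncomputable def lowSum (M : Matroid α) [M.Finite] (G : Finset α) (q : ℕ) : ℚ :=
  ∑ S ∈ SNq M G q, ((q : ℚ) - 2 - (mTr M S : ℚ)) / (1 + (mTr M S : ℚ))

/-- The weight `(q − 1)·w_∞(S)` of a spanning non-basis is `1 + (q − 2 − m(S))/(1 + m(S))`. -/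
theorem weight_three_eq (q : ℕ) (S : Finset α) :
    ((q : ℚ) - 1) * wInf M S = 1 + ((q : ℚ) - 2 - (mTr M S : ℚ)) / (1 + (mTr M S : ℚ)) := by
  unfold wInf
  have hpos : (0 : ℚ) < 1 + (mTr M S : ℚ) := by positivity
  field_simp
  ring

/-- The weight `(q − 1)·w_∞(B)` of a basis is `(q − 1)/(q + 1)`. -/
theorem weight_three_eq_of_mem_Bq {G B : Finset α} {q : ℕ} (hB : B ∈ Bq M G q) :
    ((q : ℚ) - 1) * wInf M B = ((q : ℚ) - 1) / ((q : ℚ) + 1) := by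
  rw [wInf_eq_of_mem_Bq hB]
  ring

omit [DecidableEq α] in
/-- `#SN_q = N_q − #𝓑_q`. -/
theorem card_SNq_eq (G : Finset α) (q : ℕ) :
    ((SNq M G q).card : ℚ) = (Nq M G q : ℚ) - ((Bq M G q).card : ℚ) := by
  have h := Finset.card_filter_add_card_filter_not (s := Rq M G q) (fun B : Finset α => B.card = q)
  unfold Nq Bq SNq
  have h' : ((Rq M G q).card : ℚ) =
      (((Rq M G q).filter (fun B : Finset α => B.card = q)).card : ℚ) +
        (((Rq M G q).filter (fun B : Finset α => ¬ B.card = q)).card : ℚ) := by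
    exact_mod_cast h.symm
  linarith

/-- The weighted sum over `R_q(G)` at type `3`:
`Σ_S (q − 1)·w_∞(S) = (q − 1)/(q + 1)·#𝓑 + #SN_q + lowSum`. -/
theorem sum_weight_three_eq (G : Finset α) (q : ℕ) :
    ∑ S ∈ Rq M G q, ((q : ℚ) - 1) * wInf M S =
      ((q : ℚ) - 1) / ((q : ℚ) + 1) * ((Bq M G q).card : ℚ) + ((SNq M G q).card : ℚ) + lowSum M G q := by
  rw [sum_Rq_eq_sum_Bq_add_sum_SNq]
  rw [Finset.sum_congr rfl (fun B hB => weight_three_eq_of_mem_Bq hB),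
    Finset.sum_congr rfl (fun S _ => weight_three_eq (M := M) q S)]
  rw [Finset.sum_const, nsmul_eq_mul, Finset.sum_add_distrib, Finset.sum_const, nsmul_eq_mul]
  unfold lowSum
  ring

/-! ## Lemma A -/

/-- **Lemma A** (the type-`3` balance as a counting identity):
`J_3 = DF_3 − (N_q − DF_3 + 2·#𝓑)/(q + 1) + Σ_{S spanning non-basis} (q − 2 − m(S))/(1 + m(S))`. -/
theorem Jq_three_eq (G : Finset α) (q : ℕ) :
    Jq M G q 3 =
      (DFq M G q 3 : ℚ) -
        ((Nq M G q : ℚ) - (DFq M G q 3 : ℚ) + 2 * ((Bq M G q).card : ℚ)) / ((q : ℚ) + 1) +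
        lowSum M G q := by
  unfold Jq
  have hw : ∑ B ∈ Rq M G q, ((q : ℚ) + 2 - ((3 : ℕ) : ℚ)) * wInf M B =
      ∑ S ∈ Rq M G q, ((q : ℚ) - 1) * wInf M S := by
    apply Finset.sum_congr rfl
    intro S _
    push_cast
    ring
  rw [hw, sum_weight_three_eq, card_SNq_eq]
  have hpos : (0 : ℚ) < (q : ℚ) + 1 := by positivity
  field_simp
  ring

/-! ## Corollary A1: the coloop tail -/

/-- On a simple matroid the low-coloop sum is nonnegative (`m(S) ≤ q − 2` on every spanning non-basis). -/
theorem lowSum_nonneg (hs : Simple M) {G : Finset α} {q : ℕ} (hG : G ⊆ gr M) (hq : 1 ≤ q) :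
    0 ≤ lowSum M G q := by
  unfold lowSum
  apply Finset.sum_nonneg
  intro S hS
  have hS' := mem_SNq.1 hS
  have hm := mTr_add_two_le_of_spanning_nonbasis hs (hS'.1.trans hG) hS'.2.1 hq (lt_card_of_mem_SNq hS)
  have h1 : (0 : ℚ) < 1 + (mTr M S : ℚ) := by positivity
  apply div_nonneg _ h1.le
  have : (mTr M S : ℚ) + 2 ≤ (q : ℚ) := by exact_mod_cast hm
  linarith

/-- **Corollary A1**: `J_3 ≥ DF_3 − (N_q − DF_3 + 2·#𝓑)/(q + 1)` on a simple matroid. -/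
theorem Jq_three_ge_tail (hs : Simple M) {G : Finset α} {q : ℕ} (hG : G ⊆ gr M) (hq : 1 ≤ q) :
    (DFq M G q 3 : ℚ) - ((Nq M G q : ℚ) - (DFq M G q 3 : ℚ) + 2 * ((Bq M G q).card : ℚ)) / ((q : ℚ) + 1) ≤
      Jq M G q 3 := by
  rw [Jq_three_eq]
  linarith [lowSum_nonneg hs hG hq]

/-- **The coloop tail closes the type-`3` balance**: if `N_q − DF_3 + 2·#𝓑 ≤ (q + 1)·DF_3` then `0 ≤ J_3`
(for `G = N ⊕ (q − r) coloops` the three counts do not depend on the number of coloops, so this holds for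
every large enough `q`). -/
theorem Jq_three_nonneg_of_tail (hs : Simple M) {G : Finset α} {q : ℕ} (hG : G ⊆ gr M) (hq : 1 ≤ q)
    (h : (Nq M G q : ℚ) - (DFq M G q 3 : ℚ) + 2 * ((Bq M G q).card : ℚ) ≤ ((q : ℚ) + 1) * (DFq M G q 3 : ℚ)) :
    0 ≤ Jq M G q 3 := by
  have htail := Jq_three_ge_tail hs hG hq
  have hpos : (0 : ℚ) < (q : ℚ) + 1 := by positivity
  have hdiv : ((Nq M G q : ℚ) - (DFq M G q 3 : ℚ) + 2 * ((Bq M G q).card : ℚ)) / ((q : ℚ) + 1) ≤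
      (DFq M G q 3 : ℚ) := by
    rw [div_le_iff₀ hpos]
    linarith
  linarith

end PercRepro.Star
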